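import Summits.QuantumFields.GaugeBoot.DiagonalRPTorusTubeEstimateOdd
import Summits.QuantumFields.GaugeBoot.DiagonalRPTorusNegativeUnitary
import HarnessLib

/-!
# Closed-half diagonal RP fails on every odd torus `(ℤ/L)^d`, `d ≥ 4`, `L ≥ 3`, for `SU(N)` and
`U(N)` at small coupling (gauge-boot, task L3 sequel, odd case 4/4 — main file)

HONEST FRAMING (cell `pub-gaugeboot`, page 1 of every file): the venture produces certified bounds
on lattice expectations at stated coupling, gauge group, dimension and torus size; NOT a mass gap,
NOT a continuum limit, NOT a string tension; NOT Yang–Mills-summit-bearing (barriers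
`FixedCouplingUltralocality`, `PerturbativeInvisibility`). This module is a structural NEGATIVE
result about which positivity constraints a TORUS certificate may use; it discharges nothing else.

## Content

The odd companion of `DiagonalRPTorusInnerHalfNegativeHighDimMain` (the tree's odd-torus
negatives `DiagRPSUN.not_diagonalReflectionPositive_odd_suN` / `_odd_unitary` are
three-dimensional); for EVERY `d ≥ 4` (`i < j < k < l`) and EVERY odd `L ≥ 3`:
**`trickForm_witness_odd_le`** (`trickForm ≤ -2 β⁴ c₁⁵ N + β⁵ C(L, N, d)`),
**`not_diagonalReflectionPositive_odd_highDim_of_moments`** (centre element + (R1), `c₁ > 0`: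
`∃ β₀ > 0, ∀ 0 < β ≤ β₀, ¬ DiagonalReflectionPositive (d := d) (L := L) ρ β i j`),
**`_specialUnitary`** (`SU(N)`, `N ≥ 2`), **`_unitary`** (`U(N)`, `N ≥ 1`), and the concrete
**`not_diagonalReflectionPositive_odd_suN_highDim`** / **`_uN_highDim`** (mirror `x₀ = x₁`).

MECHANISM: the half-action trick with the closed half `δ.val ≤ L/2` (`h = c + 1`, `L = 2c + 1`);
the top layer `c` and its mirror image `-c = c + 1` are ADJACENT, the witness squares
`p = sq k l (c e_i)`, `p̃ = sq k l (θ(c e_i) - e_i)` are joined to `θp̃`, `θp` by SHORT tubes of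
four faces, the only terms of order `≤ β⁴` (`tube_shape_odd`), each `= β⁴ c₁⁵ N + O(β⁵)`.
`β₀ = β₀(L, N, d)` existential. MEANING: with the even case, for the venture's own gauge groups the
torus transplants of diagonal RP fail on EVERY torus `(ℤ/L)^d`, `d ≥ 4`, `L ≥ 3`, at small
coupling; in `d = 3` only `L = 4` remains open. Elementary; not in print as far as searched
(printed precedent, spin systems, no proof: FILS 1980 §3; Biskup 2009 §5.5).
-/

open MeasureTheory Finset Function
open scoped ComplexOrder

namespace Summit.QuantumFields.GaugeBoot

open Literature.MathematicalPhysics.QuantumFieldTheory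
open Literature.MathematicalPhysics.QuantumFieldTheory.PlaquetteLowerBound (reTr)
open Literature.RepresentationTheory.CompactGroups
open Summit.Ventures.YMGap.RobustBall (one_ne_zero_of_three_le two_ne_zero_of_three_le)

noncomputable section

namespace DiagRPTube

variable {d L : ℕ} [NeZero L] {N : ℕ} {G : Type*} [Group G] [TopologicalSpace G]
  [IsTopologicalGroup G] [CompactSpace G] [MeasurableSpace G] [BorelSpace G]
  [SecondCountableTopology G] (ρ : G →* Matrix (Fin N) (Fin N) ℂ)
  {i j k l : Fin d} (hij : i < j) (hjk : j < k) (hkl : k < l) {c : ℕ} (hc : 1 ≤ c)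
  (hL : L = 2 * c + 1)

/-- The odd WITNESS BASE `y₀ = c e_i`. -/
def baseOdd (i : Fin d) (c : ℕ) : Site d L := Pi.single i ((c : ℕ) : ZMod L)
/-- The second odd witness base `x₁ = θ y₀ - e_i = c e_j - e_i`. -/
def baseOdd' (i j : Fin d) (c : ℕ) : Site d L := dn (Pi.single j ((c : ℕ) : ZMod L)) i

section Geometry

omit [NeZero L]
include hij in
/-- `δ(y₀) = c`. -/
theorem lay_baseOdd : lay i j (baseOdd (L := L) i c) = ((c : ℕ) : ZMod L) := by
  have hij' : i ≠ j := ne_of_lt hij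
  simp [lay, baseOdd, Pi.single_eq_of_ne hij'.symm]

include hij hL in
/-- `δ(x₁) = c`. -/
theorem lay_baseOdd' : lay i j (baseOdd' (L := L) i j c) = ((c : ℕ) : ZMod L) := by
  have hij' : i ≠ j := ne_of_lt hij
  unfold baseOdd'
  rw [lay_dn_i hij']
  simp only [lay, Pi.single_eq_of_ne hij', Pi.single_eq_same]
  have e := neg_cast_succ_odd (L := L) hL
  push_cast at e
  linear_combination e

include hij in
/-- `θ y₀ = x₁ + e_i`. -/
theorem swap_baseOdd : siteDiagSwap i j (baseOdd (L := L) i c) = (baseOdd' (L := L) i j c).shift i := by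
  unfold baseOdd baseOdd'
  rw [siteDiagSwap_single hij, dn_shift]

include hij in
/-- `θ x₁ = y₀ - e_j`. -/
theorem swap_baseOdd' : siteDiagSwap i j (baseOdd' (L := L) i j c) = dn (baseOdd (L := L) i c) j := by
  unfold baseOdd baseOdd'
  rw [siteDiagSwap_dn_i]
  congr 1
  have h := congrArg (siteDiagSwap (L := L) i j) (siteDiagSwap_single (L := L) hij ((c : ℕ) : ZMod L))
  rw [siteDiagSwap_siteDiagSwap] at h
  exact h.symm

include hc hL in
/-- `c ∉ {0, -1}` in `ℤ/(2c+1)`. -/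
theorem cast_c_ne_values_odd : ((c : ℕ) : ZMod L) ≠ 0 ∧ ((c : ℕ) : ZMod L) + 1 ≠ 0 := by
  refine ⟨cast_c_ne_zero_odd hc hL, ?_⟩
  rw [← Nat.cast_add_one]
  intro h
  rw [ZMod.natCast_eq_zero_iff] at h
  exact absurd (Nat.le_of_dvd (by omega) h) (by omega)

include hij hc hL in
/-- **The diagonal pair `(θp, p)` has no short-tube offset.** -/
theorem offsets_odd_pp : siteDiagSwap i j (baseOdd (L := L) i c) ≠ (baseOdd (L := L) i c).shift i ∧
    siteDiagSwap i j (baseOdd (L := L) i c) ≠ dn (baseOdd (L := L) i c) j := by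
  have hij' : i ≠ j := ne_of_lt hij
  obtain ⟨h0, h1⟩ := cast_c_ne_values_odd hc hL
  unfold baseOdd
  rw [siteDiagSwap_single hij]
  refine ⟨fun h => ?_, fun h => ?_⟩ <;>
  · have e := congrFun h j
    simp only [Site.shift, dn, Pi.add_apply, Pi.sub_apply, Pi.single_eq_same,
      Pi.single_eq_of_ne hij'.symm] at e
    first
      | exact h0 (by linear_combination e)
      | exact h1 (by linear_combination e)

include hij hc hL in
/-- **The diagonal pair `(θp̃, p̃)` has no short-tube offset.** -/
theorem offsets_odd_pp' : siteDiagSwap i j (baseOdd' (L := L) i j c) ≠ (baseOdd' (L := L) i j c).shift i ∧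
    siteDiagSwap i j (baseOdd' (L := L) i j c) ≠ dn (baseOdd' (L := L) i j c) j := by
  have hij' : i ≠ j := ne_of_lt hij
  obtain ⟨h0, h1⟩ := cast_c_ne_values_odd hc hL
  rw [swap_baseOdd' hij]
  unfold baseOdd baseOdd'
  refine ⟨fun h => ?_, fun h => ?_⟩ <;>
  · have e := congrFun h i
    simp only [Site.shift, dn, Pi.add_apply, Pi.sub_apply, Pi.single_eq_same,
      Pi.single_eq_of_ne hij'] at e
    first
      | exact h0 (by linear_combination e)
      | exact h1 (by linear_combination e)

end Geometry


section Estimate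

variable (hρ : Continuous ρ) {z₀ : G} {ω : ℂ} (hz₀ : ρ z₀ = ω • (1 : Matrix (Fin N) (Fin N) ℂ))
  (hω : ω ≠ 1) {c₁ : ℝ}
  (hR1 : ∀ x y : G, ∫ g, reTr ρ (x * g⁻¹) * reTr ρ (g * y) ∂haarProbability G = c₁ * reTr ρ (x * y))

include hij hjk hkl hc hL hρ hz₀ hω hR1

/-- ★ **THE ODD ESTIMATE**: for `0 ≤ β`, `2βN ≤ 1`,
`trickForm ≤ -2 β⁴ c₁⁵ N + β⁵ (2 N² 2⁴ N⁵ + 2^{#rest} 4 N² 2⁵ N⁵)`. -/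
theorem trickForm_witness_odd_le {β : ℝ} (hβ : 0 ≤ β) (hβN : 2 * β * N ≤ 1) :
    trickForm ρ i j (c + 1) β (fun U => WilsonRP.plaqRe ρ U (sq k l hkl (baseOdd (L := L) i c)) -
        WilsonRP.plaqRe ρ U (sq k l hkl (baseOdd' (L := L) i j c))) ≤
      -(2 * (β ^ 4 * (c₁ ^ 5 * N))) + β ^ 5 * (2 * (N ^ 2 * (2 ^ 4 * N ^ 5)) +
        2 ^ (restPlaqs (L := L) i j (c + 1)).card * (4 * (N ^ 2 * (2 ^ 5 * N ^ 5)))) := by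
  have hL3 : 3 ≤ L := by omega
  have hik : i < k := hij.trans hjk
  have hil : i < l := hij.trans (hjk.trans hkl)
  have hjl : j < l := hjk.trans hkl
  have hβN1 : β * N ≤ 1 := by nlinarith [mul_nonneg hβ (Nat.cast_nonneg N : (0 : ℝ) ≤ N)]
  set y₀ : Site d L := baseOdd (L := L) i c with hy₀
  set x₁ : Site d L := baseOdd' (L := L) i j c with hx₁
  set w₀ : Site d L := siteDiagSwap i j y₀ with hw₀
  set w₁ : Site d L := siteDiagSwap i j x₁ with hw₁
  have hly₀ : lay i j y₀ = ((c : ℕ) : ZMod L) := lay_baseOdd hij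
  have hlx₁ : lay i j x₁ = ((c : ℕ) : ZMod L) := lay_baseOdd' hij hL
  have hlw₀ : lay i j w₀ = -((c : ℕ) : ZMod L) := by rw [hw₀, lay_siteDiagSwap, hly₀]
  have hlw₁ : lay i j w₁ = -((c : ℕ) : ZMod L) := by rw [hw₁, lay_siteDiagSwap, hlx₁]
  have hw₀x : w₀ = x₁.shift i := swap_baseOdd hij
  have hw₁y : w₁ = dn y₀ j := swap_baseOdd' hij
  rw [trickForm_plaqDiff_eq_sum ρ β hρ, plaqSwap_sq hij hjk hkl, plaqSwap_sq hij hjk hkl, ← hw₀, ← hw₁]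
  set R := restPlaqs (L := L) i j (c + 1) with hR
  set T : Site d L → Site d L → Finset (Plaquette d L) → ℝ :=
    fun z x Q => pairT ρ β Q (sq k l hkl z) (sq k l hkl x) with hT
  have hTdef : ∀ z x Q, pairT ρ β Q (sq k l hkl z) (sq k l hkl x) = T z x Q := fun _ _ _ => rfl
  simp_rw [hTdef]
  rw [← sum_filter_add_sum_filter_not R.powerset (fun Q => Q.card ≤ 4)]
  have hsmall : ∀ Q ∈ R.powerset.filter (fun Q => Q.card ≤ 4),
      T w₀ y₀ Q - T w₀ x₁ Q - T w₁ y₀ Q + T w₁ x₁ Q = -(T w₀ x₁ Q) - T w₁ y₀ Q := by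
    intro Q hQ
    obtain ⟨hQR, hcard⟩ := mem_filter.1 hQ
    rw [mem_powerset] at hQR
    obtain ⟨a1, a2⟩ := offsets_odd_pp (L := L) hij hc hL
    obtain ⟨b1, b2⟩ := offsets_odd_pp' (L := L) hij hc hL
    have h1 : T w₀ y₀ Q = 0 :=
      pairT_eq_zero_of_ne_offsets_odd hij hjk hkl hc hL hρ hz₀ hω hly₀ hlw₀ a1 a2 hQR hcard
    have h4 : T w₁ x₁ Q = 0 :=
      pairT_eq_zero_of_ne_offsets_odd hij hjk hkl hc hL hρ hz₀ hω hlx₁ hlw₁ b1 b2 hQR hcard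
    rw [h1, h4]; ring
  rw [sum_congr rfl hsmall, sum_sub_distrib, sum_neg_distrib]
  have htI : ringSet hik hil x₁ ∈ R.powerset.filter (fun Q => Q.card ≤ 4) :=
    mem_filter.2 ⟨mem_powerset.2 (ringSet_i_subset_odd hij hjk hkl hc hL hlx₁),
      (card_ringSet hik hil hkl hL3 x₁).le⟩
  have htJ : ringSet hjk hjl w₁ ∈ R.powerset.filter (fun Q => Q.card ≤ 4) :=
    mem_filter.2 ⟨mem_powerset.2 (ringSet_j_subset_odd hij hjk hkl hc hL hlw₁),
      (card_ringSet hjk hjl hkl hL3 w₁).le⟩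
  have hsumI : ∑ Q ∈ R.powerset.filter (fun Q => Q.card ≤ 4), T w₀ x₁ Q =
      T w₀ x₁ (ringSet hik hil x₁) := by
    refine sum_eq_single_of_mem _ htI fun Q hQ hne => ?_
    obtain ⟨hQR, hcard⟩ := mem_filter.1 hQ
    rw [mem_powerset] at hQR
    by_contra hT0
    exact hne (eq_ringI_of_pairT_ne_zero hij hjk hkl hc hL hρ hz₀ hω hlx₁ hlw₀ hw₀x hQR hcard hT0)
  have hsumJ : ∑ Q ∈ R.powerset.filter (fun Q => Q.card ≤ 4), T w₁ y₀ Q =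
      T w₁ y₀ (ringSet hjk hjl w₁) := by
    refine sum_eq_single_of_mem _ htJ fun Q hQ hne => ?_
    obtain ⟨hQR, hcard⟩ := mem_filter.1 hQ
    rw [mem_powerset] at hQR
    by_contra hT0
    refine hne ?_
    rw [eq_ringJ_of_pairT_ne_zero hij hjk hkl hc hL hρ hz₀ hω hly₀ hlw₁ hw₁y hQR hcard hT0, ringSet, hw₁y]
  rw [hsumI, hsumJ]
  have hvI : β ^ 4 * (c₁ ^ 5 * N) - N ^ 2 * (2 ^ 4 * (β * N) ^ 5) ≤ T w₀ x₁ (ringSet hik hil x₁) := by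
    rw [← hTdef, hw₀x]
    exact pairT_ringSet_ge ρ hik hil hkl hL3 hρ hR1 hβ hβN1 x₁
  have hvJ : β ^ 4 * (c₁ ^ 5 * N) - N ^ 2 * (2 ^ 4 * (β * N) ^ 5) ≤ T w₁ y₀ (ringSet hjk hjl w₁) := by
    rw [← hTdef, pairT_comm]
    have h := pairT_ringSet_ge ρ hjk hjl hkl hL3 hρ hR1 hβ hβN1 w₁
    rwa [hw₁y, dn_shift, ← hw₁y] at h
  have hlarge : ∀ Q ∈ R.powerset.filter (fun Q => ¬ Q.card ≤ 4),
      T w₀ y₀ Q - T w₀ x₁ Q - T w₁ y₀ Q + T w₁ x₁ Q ≤ 4 * (N ^ 2 * (2 * β * N) ^ 5) := by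
    intro Q hQ
    obtain ⟨-, hcard⟩ := mem_filter.1 hQ
    have hb : ∀ z x, |T z x Q| ≤ N ^ 2 * (2 * β * N) ^ 5 := fun z x => by
      rw [← hTdef]
      refine (abs_pairT_le ρ β hρ hβ hβN1 Q _ _).trans ?_
      exact mul_le_mul_of_nonneg_left (pow_le_pow_of_le_one (by positivity) hβN (by omega))
        (by positivity)
    have h1 := hb w₀ y₀; have h2 := hb w₀ x₁; have h3 := hb w₁ y₀; have h4 := hb w₁ x₁
    rw [abs_le] at h1 h2 h3 h4
    linarith [h1.2, h2.1, h3.1, h4.2]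
  have hsum2 : ∑ Q ∈ R.powerset.filter (fun Q => ¬ Q.card ≤ 4),
      (T w₀ y₀ Q - T w₀ x₁ Q - T w₁ y₀ Q + T w₁ x₁ Q) ≤
      2 ^ R.card * (4 * (N ^ 2 * (2 * β * N) ^ 5)) := by
    refine (sum_le_sum hlarge).trans ?_
    rw [sum_const, nsmul_eq_mul]
    refine mul_le_mul_of_nonneg_right ?_ (by positivity)
    have : ((R.powerset.filter (fun Q => ¬ Q.card ≤ 4)).card : ℝ) ≤ (R.powerset.card : ℝ) := by
      exact_mod_cast card_filter_le _ _
    rw [card_powerset] at this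
    exact_mod_cast this
  have hpow5 : (2 * β * N) ^ 5 = β ^ 5 * (2 ^ 5 * N ^ 5) := by ring
  have hpow5' : (β * N) ^ 5 = β ^ 5 * N ^ 5 := by ring
  rw [hpow5] at hsum2
  rw [hpow5'] at hvI hvJ
  nlinarith [hsum2, hvI, hvJ]

end Estimate


section Main

include hij hjk hkl in
omit [NeZero L] [TopologicalSpace G] [IsTopologicalGroup G] [CompactSpace G] [MeasurableSpace G]
  [BorelSpace G] [SecondCountableTopology G] in
/-- The odd witness observable is a closed-half observable (`L = 2c+1`, both squares on the layer
`c`). -/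
theorem isDiagonalHalfObservable_witness_odd (hL : L = 2 * c + 1) :
    IsDiagonalHalfObservable i j fun U : GaugeConfig d L G =>
      WilsonRP.plaqRe ρ U (sq k l hkl (baseOdd (L := L) i c)) -
        WilsonRP.plaqRe ρ U (sq k l hkl (baseOdd' (L := L) i j c)) := by
  have hki : k ≠ i := (ne_of_lt (hij.trans hjk)).symm
  have hkj : k ≠ j := (ne_of_lt hjk).symm
  have hli : l ≠ i := (ne_of_lt (hij.trans (hjk.trans hkl))).symm
  have hlj : l ≠ j := (ne_of_lt (hjk.trans hkl)).symm
  have hL2 : L / 2 = c := by omega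
  have hv : ((c : ℕ) : ZMod L).val ≤ L / 2 := by rw [hL2, val_cast (by omega)]
  intro U V hUV
  have key : ∀ y : Site d L, lay i j y = ((c : ℕ) : ZMod L) →
      WilsonRP.plaqRe ρ U (sq k l hkl y) = WilsonRP.plaqRe ρ V (sq k l hkl y) := by
    intro y hy
    refine plaqRe_congr ρ _ fun a => hUV _ ?_ ?_
    · show (lay i j (link (sq k l hkl y) a).1).val ≤ L / 2
      rw [link_sq, lay_eStart hki hkj hli hlj, hy]; exact hv
    · show (lay i j ((link (sq k l hkl y) a).1.shift (link (sq k l hkl y) a).2)).val ≤ L / 2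
      rw [link_sq]
      show (lay i j (eEnd k l y a)).val ≤ L / 2
      rw [lay_eEnd hij hjk hkl, hy]; exact hv
  simp only [key _ (lay_baseOdd hij), key _ (lay_baseOdd' hij hL)]

include hij hjk hkl in
/-- ★ **Closed-half diagonal RP fails on every odd torus `(ℤ/L)^d`, `d ≥ 4`, `L ≥ 3`, at small
coupling, from the character moments** (centre element and (R1) with `c₁ > 0`). -/
theorem not_diagonalReflectionPositive_odd_highDim_of_moments (hLodd : Odd L) (h3 : 3 ≤ L)
    (hρ : Continuous ρ) (hN : 1 ≤ N) {z₀ : G} {ω : ℂ}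
    (hz₀ : ρ z₀ = ω • (1 : Matrix (Fin N) (Fin N) ℂ)) (hω : ω ≠ 1) {c₁ : ℝ} (hc₁ : 0 < c₁)
    (hR1 : ∀ x y : G, ∫ g, reTr ρ (x * g⁻¹) * reTr ρ (g * y) ∂haarProbability G =
      c₁ * reTr ρ (x * y)) :
    ∃ β₀ : ℝ, 0 < β₀ ∧ ∀ β : ℝ, 0 < β → β ≤ β₀ →
      ¬ DiagonalReflectionPositive (d := d) (L := L) ρ β i j := by
  obtain ⟨c, hcc⟩ := hLodd
  have hL : L = 2 * c + 1 := by omega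
  have hc : 1 ≤ c := by omega
  have hL2 : L / 2 + 1 = c + 1 := by omega
  have hNpos : (0 : ℝ) < N := by exact_mod_cast hN
  set C : ℝ := 2 * (N ^ 2 * (2 ^ 4 * N ^ 5)) +
    2 ^ (restPlaqs (L := L) i j (c + 1)).card * (4 * (N ^ 2 * (2 ^ 5 * N ^ 5))) with hC
  have hCpos : 0 < C := by positivity
  have hK : 0 < c₁ ^ 5 * N := by positivity
  refine ⟨min (1 / (2 * N)) (c₁ ^ 5 * N / C), lt_min (by positivity) (by positivity),
    fun β hβ hβ0 => ?_⟩
  have hγ : 2 * β * N ≤ 1 := by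
    have h := (le_min_iff.1 hβ0).1
    rw [le_div_iff₀ (by positivity)] at h
    linarith
  have hβC : β * C ≤ c₁ ^ 5 * N := by
    have h := (le_min_iff.1 hβ0).2
    rwa [le_div_iff₀ hCpos] at h
  have hneg : trickForm ρ i j (L / 2 + 1) β (fun U : GaugeConfig d L G =>
      WilsonRP.plaqRe ρ U (sq k l hkl (baseOdd (L := L) i c)) -
        WilsonRP.plaqRe ρ U (sq k l hkl (baseOdd' (L := L) i j c))) < 0 := by
    rw [hL2]
    have h := trickForm_witness_odd_le ρ hij hjk hkl hc hL hρ hz₀ hω hR1 hβ.le hγ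
    have h4 : 0 < β ^ 4 := pow_pos hβ 4
    have : -(2 * (β ^ 4 * (c₁ ^ 5 * N))) + β ^ 5 * C = β ^ 4 * (β * C - 2 * (c₁ ^ 5 * N)) := by ring
    rw [this] at h
    nlinarith [mul_pos h4 hK]
  exact not_diagonalReflectionPositive_of_trickForm_neg ρ hρ ⟨c, hcc⟩
    (((continuous_plaqRe ρ hρ _).sub (continuous_plaqRe ρ hρ _)))
    (isDiagonalHalfObservable_witness_odd ρ hij hjk hkl hL) hneg

include hij hjk hkl in
/-- ★★ **`G ≅ SU(N)` (`N ≥ 2`): closed-half diagonal RP fails on every odd torus `(ℤ/L)^d`,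
`d ≥ 4`, `L ≥ 3`, at small coupling.** -/
theorem not_diagonalReflectionPositive_odd_highDim_specialUnitary (hρ : IsSpecialUnitaryModel ρ)
    (hN : 2 ≤ N) (hLodd : Odd L) (h3 : 3 ≤ L) :
    ∃ β₀ : ℝ, 0 < β₀ ∧ ∀ β : ℝ, 0 < β → β ≤ β₀ →
      ¬ DiagonalReflectionPositive (d := d) (L := L) ρ β i j := by
  obtain ⟨z₀, ω, hω, hz₀⟩ := DiagRPSUN.exists_smul_one ρ hρ hN
  obtain ⟨c₁, hc₁, hR1⟩ := DiagRPSUN.exists_re_conv_const ρ hρ hN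
  exact not_diagonalReflectionPositive_odd_highDim_of_moments ρ hij hjk hkl hLodd h3 hρ.1 (by omega)
    hz₀ hω hc₁ hR1

include hij hjk hkl in
/-- ★★ **`G ≅ U(N)` (`N ≥ 1`): closed-half diagonal RP fails on every odd torus `(ℤ/L)^d`,
`d ≥ 4`, `L ≥ 3`, at small coupling.** -/
theorem not_diagonalReflectionPositive_odd_highDim_unitary (hρ : IsUnitaryModel ρ) (hN : 1 ≤ N)
    (hLodd : Odd L) (h3 : 3 ≤ L) :
    ∃ β₀ : ℝ, 0 < β₀ ∧ ∀ β : ℝ, 0 < β → β ≤ β₀ →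
      ¬ DiagonalReflectionPositive (d := d) (L := L) ρ β i j := by
  obtain ⟨z₀, ω, hω, hz₀⟩ := DiagRPSUN.exists_smul_one_unitary ρ hρ
  have hNpos : (0 : ℝ) < N := by exact_mod_cast hN
  exact not_diagonalReflectionPositive_odd_highDim_of_moments ρ hij hjk hkl hLodd h3 hρ.1 hN hz₀ hω
    (c₁ := (2 * N : ℝ)⁻¹) (by positivity) (DiagRPSUN.integral_re_trace_mul_inv_mul_unitary ρ hρ)

end Main


section Concrete

open Literature.MathematicalPhysics.QuantumLattice

omit [NeZero L] in
/-- ★★ **`SU(N)` lattice gauge theory (`N ≥ 2`) violates closed-half diagonal RP on every odd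
torus `(ℤ/L)^d`, `d ≥ 4`, `L ≥ 3`, for all sufficiently small `β > 0`** (not vacuous). -/
theorem not_diagonalReflectionPositive_odd_suN_highDim {d L N : ℕ} [NeZero L] (hd : 4 ≤ d)
    (hN : 2 ≤ N) (hLodd : Odd L) (h3 : 3 ≤ L) :
    ∃ β₀ : ℝ, 0 < β₀ ∧ ∀ β : ℝ, 0 < β → β ≤ β₀ →
      ¬ DiagonalReflectionPositive (d := d) (L := L) (fundamentalRep (Fin N)) β ⟨0, by omega⟩
        ⟨1, by omega⟩ := by
  haveI : SecondCountableTopology (Matrix (Fin N) (Fin N) ℂ) :=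
    inferInstanceAs (SecondCountableTopology (Fin N → Fin N → ℂ))
  haveI : SecondCountableTopology (Matrix.specialUnitaryGroup (Fin N) ℂ) :=
    Topology.IsEmbedding.subtypeVal.secondCountableTopology
  have h2 : 2 < d := by omega
  have h3' : 3 < d := by omega
  have hij : (⟨0, by omega⟩ : Fin d) < ⟨1, by omega⟩ := Fin.mk_lt_mk.2 (by norm_num)
  have hjk : (⟨1, by omega⟩ : Fin d) < ⟨2, h2⟩ := Fin.mk_lt_mk.2 (by norm_num)
  have hkl : (⟨2, h2⟩ : Fin d) < ⟨3, h3'⟩ := Fin.mk_lt_mk.2 (by norm_num)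
  exact not_diagonalReflectionPositive_odd_highDim_specialUnitary (fundamentalRep (Fin N)) hij hjk hkl
    (TorusAreaLaw.isSpecialUnitaryModel_fundamentalRep N) hN hLodd h3

omit [NeZero L] in
/-- ★★ **`U(N)` lattice gauge theory (`N ≥ 1`) violates closed-half diagonal RP on every odd
torus `(ℤ/L)^d`, `d ≥ 4`, `L ≥ 3`, for all sufficiently small `β > 0`** (not vacuous). -/
theorem not_diagonalReflectionPositive_odd_uN_highDim {d L N : ℕ} [NeZero L] (hd : 4 ≤ d)
    (hN : 1 ≤ N) (hLodd : Odd L) (h3 : 3 ≤ L) :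
    ∃ β₀ : ℝ, 0 < β₀ ∧ ∀ β : ℝ, 0 < β → β ≤ β₀ →
      ¬ DiagonalReflectionPositive (d := d) (L := L) (unitaryFundamentalRep (Fin N) ℂ) β
        ⟨0, by omega⟩ ⟨1, by omega⟩ := by
  haveI : SecondCountableTopology (Matrix.unitaryGroup (Fin N) ℂ) :=
    IsUnitaryModel.secondCountableTopology _ (isUnitaryModel_unitaryFundamentalRep N)
  have h2 : 2 < d := by omega
  have h3' : 3 < d := by omega
  have hij : (⟨0, by omega⟩ : Fin d) < ⟨1, by omega⟩ := Fin.mk_lt_mk.2 (by norm_num)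
  have hjk : (⟨1, by omega⟩ : Fin d) < ⟨2, h2⟩ := Fin.mk_lt_mk.2 (by norm_num)
  have hkl : (⟨2, h2⟩ : Fin d) < ⟨3, h3'⟩ := Fin.mk_lt_mk.2 (by norm_num)
  exact not_diagonalReflectionPositive_odd_highDim_unitary (unitaryFundamentalRep (Fin N) ℂ) hij hjk hkl
    (isUnitaryModel_unitaryFundamentalRep N) hN hLodd h3

end Concrete

end DiagRPTube

end

end Summit.QuantumFields.GaugeBoot
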